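import Summits.Ventures.HSemireg.WedgeHankelRecurrenceCensusToeplitz
import Literature.Combinatorics.SimpleGraph.CharpolyAdjugateSquareRoot

/-!
# Venture HSemireg — DODGSON CONDENSATION ∕ THE DESNANOT–JACOBI–SYLVESTER IDENTITY FOR HANKEL DETERMINANTS:
# **`det H_{t+2}(s) · det H_t(s∘(·+2)) = det H_{t+1}(s) · det H_{t+1}(s∘(·+2)) − det H_{t+1}(s∘(·+1))²`** for EVERY sequence `s` — the array `τ(k, n) = det H_n(m ↦ s(m+k))` of all shifted Hankel
# determinants satisfies the bilinear (discrete-Toda) relation `τ(k, t+2) τ(k+2, t) = τ(k, t+1) τ(k+2, t+1) − τ(k+1, t+1)²`; the condensation step in division form; geometric progression of the middle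
# determinants when an outer one vanishes; zero propagation; and the same for the lineage's one-sided TOEPLITZ windows: **`det T_{t+2}(q) det T_t(q∘(·+2)) = det T_{t+1}(q∘(·+1))² − det T_{t+1}(q) det T_{t+1}(q∘(·+2))`**

HONEST FRAMING. Part of the Lean index of the computation cell `pub-hsemireg` (seat p10 gen 37, Sunday typer «UNIFORM-IN-n»).
DETERMINANTS OF HANKEL ∕ TOEPLITZ MATRICES OVER A FIELD ONLY (`Matrix.det`, `Matrix.adjugate`, the lineage's `hankelSq` ∕ `toeplitzSq`; the identities hold verbatim over any commutative ring, the
file keeps the lineage's field-valued sequences): no variety, no cohomology theory, no sheaf, no Ext group and no semiregularity map is constructed here; nothing here says that HC / HC_CM / HC_AV holds; no Literature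
fact (unproved `Prop`) is declared or used — the PROVED Literature theorem `Literature.Combinatorics.SimpleGraph.CharpolyAdjugateSquareRoot.det_mul_det_submatrix_pair` (Jacobi ∕ Desnanot–Jacobi
in cofactor form `det A · det A[{i,j}ᶜ] = adj(A)_{ii} adj(A)_{jj} − adj(A)_{ij} adj(A)_{ji}`, itself from `Literature.LinearAlgebra.Matrix.DodgsonCondensation.det_mul_det_submatrix_compl_pair`,
Horn–Johnson 0.8.11) is IMPORTED and specialised.  Custodian versions as in `WedgeHankelSiegelIdeal` (1/3).
SOURCE OF THE STATEMENT (cited; held text read): the «condensation formula» for shifted Hankel determinants `H_n^{(k)} H_{n−2}^{(k+2)} = H_{n−1}^{(k)} H_{n−1}^{(k+2)} − (H_{n−1}^{(k+1)})²`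
(`H_n^{(k)} = det (a_{k+i+j})_{0 ≤ i,j ≤ n−1}`) as printed in *Hankel determinants and shifted periodic continued fractions*, arXiv:1806.08927 (Adv. Appl. Math. 2019), p. 4, there attributed to
Dodgson (Proc. Roy. Soc. 15 (1866) 150–155), Brualdi–Schneider (LAA 52/53 (1983)) and Krattenthaler (*Advanced determinant calculus*, Sém. Lothar. Combin. 42 (1999) B42q); it is Dodgson's
`e · det A = a d − b c` for `A = H_{t+2}(s)`: the four `(t+2) × (t+2)` corner blocks of a square Hankel matrix are the Hankel matrices of `s`, `s∘(·+1)` (twice) and `s∘(·+2)`, its centre is `H_t(s∘(·+2))`.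
presearch: «Desnanot–Jacobi ∕ condensation for Hankel determinants» → [corpus: paper:arxiv-1806.08927 p. 4] the printed formula; [tree] the general identity (Literature, above); galaxy «Desnanot|Dodgson
condensation» → expository hits only (Rice–Torrence 2007), nothing Lean-side.
DEDUP DISCLOSURE (`rg` of the whole tree + Mathlib, 2026-09-01): `hankelSq` corner blocks appear in the lineage only as `hankelSq_submatrix_castLE` (N159 `RealRootsSubresultant`, leading block) and the leading-zeros corner of
N166; no file of the tree specialises Dodgson ∕ Desnanot–Jacobi to Hankel (or Toeplitz) matrices; `Matrix.adjugate` is not used anywhere in `WedgeHankelRecurrence*`.  21 names: 0 hits tree-wide.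

WHAT IS IN THE TREE.  N48 `CensusDet`: `hankelSq` (`(t+1) × (t+1)`, entries `q (i + j)`); N49 `CensusToeplitz`: `toeplitzSq` (entries `q (t + i − j)`), `det_toeplitzSq` (`= sign(rev) · det hankelSq`).  Literature: **`CharpolyAdjugateSquareRoot.det_mul_det_submatrix_pair`** (any `Fintype` index, any commutative
ring).  Mathlib: `Matrix.adjugate_fin_succ_eq_det_submatrix` (`adj(A)_{ij} = (−1)^{i+j} det A[ĵ, î]` on `Fin (n+1)`), `Fin.succAbove_zero ∕ _last`, `Matrix.det_submatrix_equiv_self`, `Matrix.det_fin_two`.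
THIS FILE (namespace `Summit.Ventures.HSemireg.Wedge.HankelOuter` continued; PLAIN over `CensusToeplitz` (N49, which imports `CensusDet`) + the Literature file; 0 definitions):
* §823 `hankelSq_succ_submatrix_castSucc ∕ _succ ∕ _castSucc_succ ∕ _succ_castSucc` (the four corner blocks), `det_hankelSq_submatrix_ne_zero_ne_last` (the centre, relabelled),
  `adjugate_hankelSq_succ_last_last ∕ _zero_zero`, `adjugate_hankelSq_succ_zero_last_mul` (the corner cofactors).
* §824 **`det_hankelSq_mul_det_hankelSq_shift_two`** (the identity), **`det_hankelSq_shift_mul_det_hankelSq_shift`** (the `τ`-array form, all shifts `k`), `det_hankelSq_one` (`s₀s₂ − s₁²`),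
  `det_hankelSq_succ_succ_eq_div` (condensation step), `det_hankelSq_shift_one_sq_eq` (outer zero ⇒ middle three in geometric progression), `det_hankelSq_succ_succ_mul_eq_zero` (zero propagation).
* §825 `toeplitzSq_succ_submatrix_castSucc ∕ _succ ∕ _castSucc_succ ∕ _succ_castSucc`, `det_toeplitzSq_submatrix_ne_zero_ne_last`, **`det_toeplitzSq_mul_det_toeplitzSq_shift_two`**,
  **`det_toeplitzSq_shift_mul_det_toeplitzSq_shift`** (the Toeplitz three-term identity and its array form).
CAVEATS.  Sizes are the lineage's `hankelSq K t` = `(t+1) × (t+1)`, so the identity is stated for the triple of sizes `t+1, t+2, t+3`; the degenerate first instance (empty centre) is `det_hankelSq_one`.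
Nothing Ext-side.  New names only.
-/

open Matrix

namespace Summit.Ventures.HSemireg.Wedge.HankelOuter

open Summit.Ventures.HSemireg.Wedge Summit.Ventures.HSemireg.Wedge.Hankel

section Condensation

variable {K : Type*} [Field K]

/-! ## §823. The four corner blocks and the centre of the square Hankel matrix `H_{t+1}(s)` -/

omit [Field K] in
/-- Deleting the LAST row and column of `H_{t+1}(s)` leaves `H_t(s)`. [this file, §823] -/
theorem hankelSq_succ_submatrix_castSucc (t : ℕ) (s : ℕ → K) :
    (hankelSq K (t + 1) s).submatrix Fin.castSucc Fin.castSucc = hankelSq K t s := by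
  ext i j
  simp only [Matrix.submatrix_apply, hankelSq, Matrix.of_apply, Fin.val_castSucc]

omit [Field K] in
/-- Deleting the FIRST row and column of `H_{t+1}(s)` leaves `H_t` of the twice-shifted sequence `n ↦ s (n + 2)`. [this file, §823] -/
theorem hankelSq_succ_submatrix_succ (t : ℕ) (s : ℕ → K) :
    (hankelSq K (t + 1) s).submatrix Fin.succ Fin.succ = hankelSq K t (fun n => s (n + 2)) := by
  ext i j
  simp only [Matrix.submatrix_apply, hankelSq, Matrix.of_apply, Fin.val_succ]
  congr 1; omega

omit [Field K] in
/-- Deleting the LAST row and the FIRST column of `H_{t+1}(s)` leaves `H_t` of the shifted sequence `n ↦ s (n + 1)`. [this file, §823] -/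
theorem hankelSq_succ_submatrix_castSucc_succ (t : ℕ) (s : ℕ → K) :
    (hankelSq K (t + 1) s).submatrix Fin.castSucc Fin.succ = hankelSq K t (fun n => s (n + 1)) := by
  ext i j
  simp only [Matrix.submatrix_apply, hankelSq, Matrix.of_apply, Fin.val_succ, Fin.val_castSucc, Nat.add_assoc]

omit [Field K] in
/-- Deleting the FIRST row and the LAST column of `H_{t+1}(s)` also leaves `H_t(n ↦ s (n + 1))` (Hankel symmetry). [this file, §823] -/
theorem hankelSq_succ_submatrix_succ_castSucc (t : ℕ) (s : ℕ → K) :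
    (hankelSq K (t + 1) s).submatrix Fin.succ Fin.castSucc = hankelSq K t (fun n => s (n + 1)) := by
  ext i j
  simp only [Matrix.submatrix_apply, hankelSq, Matrix.of_apply, Fin.val_succ, Fin.val_castSucc]
  congr 1; omega

/-- Deleting the first AND last rows and columns of `H_{t+2}(s)` (size `t + 3`) leaves, up to relabelling, `H_t(n ↦ s (n + 2))`: the two determinants agree. [this file, §823] -/
theorem det_hankelSq_submatrix_ne_zero_ne_last (t : ℕ) (s : ℕ → K) :
    ((hankelSq K (t + 2) s).submatrix (Subtype.val : {a : Fin (t + 3) // a ≠ 0 ∧ a ≠ Fin.last (t + 2)} → Fin (t + 3)) Subtype.val).det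
      = (hankelSq K t (fun n => s (n + 2))).det := by
  -- the relabelling `x ↦ x + 1` of `Fin (t+1)` onto the middle indices
  let e : Fin (t + 1) ≃ {a : Fin (t + 3) // a ≠ 0 ∧ a ≠ Fin.last (t + 2)} :=
    { toFun := fun x => ⟨⟨(x : ℕ) + 1, by omega⟩, by
        refine ⟨fun h => ?_, fun h => ?_⟩
        · have := congrArg Fin.val h; simp at this
        · have := congrArg Fin.val h; simp [Fin.val_last] at this; omega⟩
      invFun := fun a => ⟨(a.1 : ℕ) - 1, by
        obtain ⟨a, ha0, hal⟩ := a
        have h0 : (a : ℕ) ≠ 0 := fun h => ha0 (Fin.ext h)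
        have hl : (a : ℕ) ≠ t + 2 := fun h => hal (Fin.ext (by rw [h, Fin.val_last]))
        have := a.isLt; simp only; omega⟩
      left_inv := fun x => by ext; simp
      right_inv := fun a => by
        obtain ⟨a, ha0, hal⟩ := a
        have h0 : (a : ℕ) ≠ 0 := fun h => ha0 (Fin.ext h)
        ext; simp only; omega }
  rw [← Matrix.det_submatrix_equiv_self e]
  congr 1
  ext i j
  simp only [Matrix.submatrix_apply, hankelSq, Matrix.of_apply, e, Equiv.coe_fn_mk]
  congr 1; omega

/-- The `(last, last)` cofactor of `H_{t+1}(s)` is `det H_t(s)`. [this file, §823] -/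
theorem adjugate_hankelSq_succ_last_last (t : ℕ) (s : ℕ → K) :
    (hankelSq K (t + 1) s).adjugate (Fin.last (t + 1)) (Fin.last (t + 1)) = (hankelSq K t s).det := by
  rw [Matrix.adjugate_fin_succ_eq_det_submatrix, Fin.succAbove_last, hankelSq_succ_submatrix_castSucc, ← two_mul, pow_mul, neg_one_sq, one_pow, one_mul]

/-- The `(0, 0)` cofactor of `H_{t+1}(s)` is `det H_t(n ↦ s (n + 2))`. [this file, §823] -/
theorem adjugate_hankelSq_succ_zero_zero (t : ℕ) (s : ℕ → K) :
    (hankelSq K (t + 1) s).adjugate 0 0 = (hankelSq K t (fun n => s (n + 2))).det := by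
  rw [Matrix.adjugate_fin_succ_eq_det_submatrix, Fin.succAbove_zero, hankelSq_succ_submatrix_succ, Fin.val_zero, add_zero, pow_zero, one_mul]

/-- The product of the two off-diagonal corner cofactors of `H_{t+1}(s)` is `(det H_t(n ↦ s (n + 1)))²` (the signs `(−1)^{t+1}` cancel). [this file, §823] -/
theorem adjugate_hankelSq_succ_zero_last_mul (t : ℕ) (s : ℕ → K) :
    (hankelSq K (t + 1) s).adjugate 0 (Fin.last (t + 1)) * (hankelSq K (t + 1) s).adjugate (Fin.last (t + 1)) 0
      = (hankelSq K t (fun n => s (n + 1))).det ^ 2 := by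
  rw [Matrix.adjugate_fin_succ_eq_det_submatrix, Matrix.adjugate_fin_succ_eq_det_submatrix, Fin.succAbove_zero, Fin.succAbove_last,
    hankelSq_succ_submatrix_castSucc_succ, hankelSq_succ_submatrix_succ_castSucc, Fin.val_zero, add_zero, zero_add]
  calc _ = ((-1 : K) ^ (Fin.last (t + 1) : ℕ) * (-1) ^ (Fin.last (t + 1) : ℕ)) * (hankelSq K t (fun n => s (n + 1))).det ^ 2 := by ring
    _ = _ := by rw [← pow_add, ← two_mul, pow_mul, neg_one_sq, one_pow, one_mul]

/-! ## §824. Dodgson condensation ∕ the Desnanot–Jacobi–Sylvester identity for Hankel determinants (the discrete Toda molecule equation of the `τ`-array `τ(k, n) = det H_n(s ∘ (· + k))`) -/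

/-- **DESNANOT–JACOBI FOR HANKEL DETERMINANTS («the condensation formula»):
`det H_{t+2}(s) · det H_t(n ↦ s (n+2)) = det H_{t+1}(s) · det H_{t+1}(n ↦ s (n+2)) − (det H_{t+1}(n ↦ s (n+1)))²`** — Dodgson's identity
`e · det A = a d − b c` for `A = H_{t+2}(s)`, whose four corner blocks are `H_{t+1}` of `s`, `s ∘ (·+1)` (twice) and `s ∘ (·+2)` and whose centre is `H_t(s ∘ (·+2))`
(tree: `Literature…CharpolyAdjugateSquareRoot.det_mul_det_submatrix_pair`, the cofactor form of `Literature…DodgsonCondensation.det_mul_det_submatrix_compl_pair`).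
(printed: arXiv:1806.08927 p. 4 «condensation formula» `H_n^{(k)} H_{n−2}^{(k+2)} = H_{n−1}^{(k)} H_{n−1}^{(k+2)} − (H_{n−1}^{(k+1)})²`; Dodgson 1866; Horn–Johnson 0.8.11.) [this file, §824] -/
theorem det_hankelSq_mul_det_hankelSq_shift_two (t : ℕ) (s : ℕ → K) :
    (hankelSq K (t + 2) s).det * (hankelSq K t (fun n => s (n + 2))).det
      = (hankelSq K (t + 1) s).det * (hankelSq K (t + 1) (fun n => s (n + 2))).det - (hankelSq K (t + 1) (fun n => s (n + 1))).det ^ 2 := by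
  have h01 : (0 : Fin (t + 3)) ≠ Fin.last (t + 2) := fun h => by have := congrArg Fin.val h; simp [Fin.val_last] at this
  have h := Literature.Combinatorics.SimpleGraph.CharpolyAdjugateSquareRoot.det_mul_det_submatrix_pair (hankelSq K (t + 2) s) h01
  rw [det_hankelSq_submatrix_ne_zero_ne_last, adjugate_hankelSq_succ_zero_zero, adjugate_hankelSq_succ_last_last, adjugate_hankelSq_succ_zero_last_mul] at h
  rw [h]; ring

/-- **The same identity on the whole shifted array (discrete Toda-molecule form): with `τ(k, n) = det H_n(m ↦ s (m + k))`,
`τ(k, t+2) τ(k+2, t) = τ(k, t+1) τ(k+2, t+1) − τ(k+1, t+1)²` for all `k, t`** (arXiv:1806.08927 p. 4, all `k`). [this file, §824] -/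
theorem det_hankelSq_shift_mul_det_hankelSq_shift (k t : ℕ) (s : ℕ → K) :
    (hankelSq K (t + 2) (fun n => s (n + k))).det * (hankelSq K t (fun n => s (n + (k + 2)))).det
      = (hankelSq K (t + 1) (fun n => s (n + k))).det * (hankelSq K (t + 1) (fun n => s (n + (k + 2)))).det
        - (hankelSq K (t + 1) (fun n => s (n + (k + 1)))).det ^ 2 := by
  have h := det_hankelSq_mul_det_hankelSq_shift_two t (fun n => s (n + k))
  simp only [Nat.add_right_comm _ 2 k, Nat.add_right_comm _ 1 k] at h
  simpa only [Nat.add_assoc] using h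

/-- The first instance, `t + 2 = 1` read with an EMPTY centre: `det H_1(s) = s₀ s₂ − s₁²`. [this file, §824] -/
theorem det_hankelSq_one (s : ℕ → K) : (hankelSq K 1 s).det = s 0 * s 2 - s 1 ^ 2 := by
  rw [Matrix.det_fin_two]
  simp only [hankelSq, Matrix.of_apply, Fin.val_zero, Fin.val_one, add_zero, zero_add]
  ring

/-- **Dodgson's condensation STEP for Hankel determinants (division form): if the centre `det H_t(n ↦ s (n+2)) ≠ 0`, then
`det H_{t+2}(s) = (det H_{t+1}(s) det H_{t+1}(s∘(·+2)) − det H_{t+1}(s∘(·+1))²) / det H_t(s∘(·+2))`** — the progressive computation of all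
`τ(k, n)` from the two rows `τ(·, 1)`, `τ(·, 2)` (arXiv:1806.08927 p. 4: «if never vanish … recursively computed using the condensation formula»). [this file, §824] -/
theorem det_hankelSq_succ_succ_eq_div {t : ℕ} {s : ℕ → K} (h : (hankelSq K t (fun n => s (n + 2))).det ≠ 0) :
    (hankelSq K (t + 2) s).det
      = ((hankelSq K (t + 1) s).det * (hankelSq K (t + 1) (fun n => s (n + 2))).det - (hankelSq K (t + 1) (fun n => s (n + 1))).det ^ 2)
          / (hankelSq K t (fun n => s (n + 2))).det := by
  rw [eq_div_iff h, det_hankelSq_mul_det_hankelSq_shift_two]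

/-- **When an OUTER determinant vanishes the three middle ones are in geometric progression**: if `det H_{t+2}(s) = 0` or `det H_t(s∘(·+2)) = 0`, then
`det H_{t+1}(s∘(·+1))² = det H_{t+1}(s) · det H_{t+1}(s∘(·+2))`. [this file, §824] -/
theorem det_hankelSq_shift_one_sq_eq {t : ℕ} {s : ℕ → K} (h : (hankelSq K (t + 2) s).det = 0 ∨ (hankelSq K t (fun n => s (n + 2))).det = 0) :
    (hankelSq K (t + 1) (fun n => s (n + 1))).det ^ 2 = (hankelSq K (t + 1) s).det * (hankelSq K (t + 1) (fun n => s (n + 2))).det := by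
  have h2 := det_hankelSq_mul_det_hankelSq_shift_two t s
  rcases h with h | h <;> rw [h] at h2 <;> simp only [zero_mul, mul_zero] at h2 <;> exact (sub_eq_zero.1 h2.symm).symm

/-- **Zero propagation along the array**: if two consecutive determinants of one size vanish, `det H_{t+1}(s) = det H_{t+1}(s∘(·+1)) = 0`, then the product of their
outer neighbours vanishes: `det H_{t+2}(s) · det H_t(s∘(·+2)) = 0`. [this file, §824] -/
theorem det_hankelSq_succ_succ_mul_eq_zero {t : ℕ} {s : ℕ → K} (h0 : (hankelSq K (t + 1) s).det = 0) (h1 : (hankelSq K (t + 1) (fun n => s (n + 1))).det = 0) :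
    (hankelSq K (t + 2) s).det * (hankelSq K t (fun n => s (n + 2))).det = 0 := by
  rw [det_hankelSq_mul_det_hankelSq_shift_two, h0, h1, zero_mul, zero_pow two_ne_zero, sub_zero]

/-! ## §825. The same for the lineage's one-sided TOEPLITZ windows `T_t(q) = (q_{t+i−j})_{i,j ≤ t}`: `det T_{t+2}(q) · det T_t(q∘(·+2)) = det T_{t+1}(q∘(·+1))² − det T_{t+1}(q) · det T_{t+1}(q∘(·+2))` -/

omit [Field K] in
/-- Deleting the LAST row and column of `T_{t+1}(q)` leaves `T_t(q∘(·+1))` (the diagonal entry moves from `q_{t+1}` to itself). [this file, §825] -/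
theorem toeplitzSq_succ_submatrix_castSucc (t : ℕ) (q : ℕ → K) :
    (toeplitzSq K (t + 1) q).submatrix Fin.castSucc Fin.castSucc = toeplitzSq K t (fun n => q (n + 1)) := by
  ext i j
  have hj := j.isLt
  simp only [Matrix.submatrix_apply, toeplitzSq, Matrix.of_apply, Fin.val_castSucc]
  congr 1; omega

omit [Field K] in
/-- Deleting the FIRST row and column of `T_{t+1}(q)` also leaves `T_t(q∘(·+1))` (Toeplitz structure). [this file, §825] -/
theorem toeplitzSq_succ_submatrix_succ (t : ℕ) (q : ℕ → K) :
    (toeplitzSq K (t + 1) q).submatrix Fin.succ Fin.succ = toeplitzSq K t (fun n => q (n + 1)) := by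
  ext i j
  have hj := j.isLt
  simp only [Matrix.submatrix_apply, toeplitzSq, Matrix.of_apply, Fin.val_succ]
  congr 1; omega

omit [Field K] in
/-- Deleting the LAST row and the FIRST column of `T_{t+1}(q)` leaves `T_t(q)`. [this file, §825] -/
theorem toeplitzSq_succ_submatrix_castSucc_succ (t : ℕ) (q : ℕ → K) :
    (toeplitzSq K (t + 1) q).submatrix Fin.castSucc Fin.succ = toeplitzSq K t q := by
  ext i j
  have hj := j.isLt
  simp only [Matrix.submatrix_apply, toeplitzSq, Matrix.of_apply, Fin.val_succ, Fin.val_castSucc]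
  congr 1; omega

omit [Field K] in
/-- Deleting the FIRST row and the LAST column of `T_{t+1}(q)` leaves `T_t(q∘(·+2))`. [this file, §825] -/
theorem toeplitzSq_succ_submatrix_succ_castSucc (t : ℕ) (q : ℕ → K) :
    (toeplitzSq K (t + 1) q).submatrix Fin.succ Fin.castSucc = toeplitzSq K t (fun n => q (n + 2)) := by
  ext i j
  have hj := j.isLt
  simp only [Matrix.submatrix_apply, toeplitzSq, Matrix.of_apply, Fin.val_succ, Fin.val_castSucc]
  congr 1; omega

/-- Deleting the first AND last rows and columns of `T_{t+2}(q)` leaves, up to relabelling, `T_t(q∘(·+2))`: the determinants agree. [this file, §825] -/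
theorem det_toeplitzSq_submatrix_ne_zero_ne_last (t : ℕ) (q : ℕ → K) :
    ((toeplitzSq K (t + 2) q).submatrix (Subtype.val : {a : Fin (t + 3) // a ≠ 0 ∧ a ≠ Fin.last (t + 2)} → Fin (t + 3)) Subtype.val).det
      = (toeplitzSq K t (fun n => q (n + 2))).det := by
  let e : Fin (t + 1) ≃ {a : Fin (t + 3) // a ≠ 0 ∧ a ≠ Fin.last (t + 2)} :=
    { toFun := fun x => ⟨⟨(x : ℕ) + 1, by omega⟩, by
        refine ⟨fun h => ?_, fun h => ?_⟩
        · have := congrArg Fin.val h; simp at this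
        · have := congrArg Fin.val h; simp [Fin.val_last] at this; omega⟩
      invFun := fun a => ⟨(a.1 : ℕ) - 1, by
        obtain ⟨a, ha0, hal⟩ := a
        have h0 : (a : ℕ) ≠ 0 := fun h => ha0 (Fin.ext h)
        have hl : (a : ℕ) ≠ t + 2 := fun h => hal (Fin.ext (by rw [h, Fin.val_last]))
        have := a.isLt; simp only; omega⟩
      left_inv := fun x => by ext; simp
      right_inv := fun a => by
        obtain ⟨a, ha0, hal⟩ := a
        have h0 : (a : ℕ) ≠ 0 := fun h => ha0 (Fin.ext h)
        ext; simp only; omega }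
  rw [← Matrix.det_submatrix_equiv_self e]
  congr 1
  ext i j
  have hj := j.isLt
  simp only [Matrix.submatrix_apply, toeplitzSq, Matrix.of_apply, e, Equiv.coe_fn_mk]
  congr 1; omega

/-- **DESNANOT–JACOBI FOR THE TOEPLITZ WINDOWS: `det T_{t+2}(q) · det T_t(q∘(·+2)) = det T_{t+1}(q∘(·+1))² − det T_{t+1}(q) · det T_{t+1}(q∘(·+2))`** — Dodgson's `e · det A = a d − b c` for
`A = T_{t+2}(q)`: both diagonal corner blocks are `T_{t+1}(q∘(·+1))`, the off-diagonal ones are `T_{t+1}(q)` and `T_{t+1}(q∘(·+2))`, the centre is `T_t(q∘(·+2))` (the classical three-term identity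
`D_n D_{n−2} = D_{n−1}² − D_{n−1}^{+} D_{n−1}^{−}` of Toeplitz determinants, in the lineage's one-sided indexing; consistent with §824 through N49 `det_toeplitzSq = sign(rev) · det hankelSq`,
the signs `sign(rev_{t+3}) sign(rev_{t+1}) = −1`). [this file, §825] -/
theorem det_toeplitzSq_mul_det_toeplitzSq_shift_two (t : ℕ) (q : ℕ → K) :
    (toeplitzSq K (t + 2) q).det * (toeplitzSq K t (fun n => q (n + 2))).det
      = (toeplitzSq K (t + 1) (fun n => q (n + 1))).det ^ 2 - (toeplitzSq K (t + 1) q).det * (toeplitzSq K (t + 1) (fun n => q (n + 2))).det := by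
  have h01 : (0 : Fin (t + 3)) ≠ Fin.last (t + 2) := fun h => by have := congrArg Fin.val h; simp [Fin.val_last] at this
  have h := Literature.Combinatorics.SimpleGraph.CharpolyAdjugateSquareRoot.det_mul_det_submatrix_pair (toeplitzSq K (t + 2) q) h01
  rw [det_toeplitzSq_submatrix_ne_zero_ne_last, Matrix.adjugate_fin_succ_eq_det_submatrix, Matrix.adjugate_fin_succ_eq_det_submatrix, Matrix.adjugate_fin_succ_eq_det_submatrix,
    Matrix.adjugate_fin_succ_eq_det_submatrix, Fin.succAbove_zero, Fin.succAbove_last, toeplitzSq_succ_submatrix_succ, toeplitzSq_succ_submatrix_castSucc,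
    toeplitzSq_succ_submatrix_castSucc_succ, toeplitzSq_succ_submatrix_succ_castSucc, Fin.val_zero] at h
  have hε : ((-1 : K) ^ (Fin.last (t + 2) : ℕ)) * (-1) ^ (Fin.last (t + 2) : ℕ) = 1 := by rw [← pow_add, ← two_mul, pow_mul, neg_one_sq, one_pow]
  rw [h]
  linear_combination ((toeplitzSq K (t + 1) (fun n => q (n + 1))).det ^ 2 - (toeplitzSq K (t + 1) q).det * (toeplitzSq K (t + 1) (fun n => q (n + 2))).det) * hε

/-- **The `τ`-array form for the Toeplitz windows: with `θ(k, n) = det T_n(m ↦ q (m + k))`, `θ(k, t+2) θ(k+2, t) = θ(k+1, t+1)² − θ(k, t+1) θ(k+2, t+1)` for all `k, t`.** [this file, §825] -/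
theorem det_toeplitzSq_shift_mul_det_toeplitzSq_shift (k t : ℕ) (q : ℕ → K) :
    (toeplitzSq K (t + 2) (fun n => q (n + k))).det * (toeplitzSq K t (fun n => q (n + (k + 2)))).det
      = (toeplitzSq K (t + 1) (fun n => q (n + (k + 1)))).det ^ 2
        - (toeplitzSq K (t + 1) (fun n => q (n + k))).det * (toeplitzSq K (t + 1) (fun n => q (n + (k + 2)))).det := by
  have h := det_toeplitzSq_mul_det_toeplitzSq_shift_two t (fun n => q (n + k))
  simp only [Nat.add_right_comm _ 2 k, Nat.add_right_comm _ 1 k] at h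
  simpa only [Nat.add_assoc] using h

end Condensation

end Summit.Ventures.HSemireg.Wedge.HankelOuter
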